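import Mathlib
import Summits.ValiantsHypothesis.ValiantsHypothesis.Theses.LiouvilleSarnak
import Summits.ValiantsHypothesis.ValiantsHypothesis.Theorems.LiouvilleSarnakLiouvilleCutRankBlockEntropy

/-!
# Route LiouvilleSarnak — crux `LiouvilleCutRank` (stmt-ValiantsHypothesis-14775):
# the STRUCTURE of a counterexample cut (unconditional, explicit)

The entropy criterion of `Theorems/LiouvilleSarnakLiouvilleCutRankBlockEntropy.lean` was stated as a
conditional bridge.  This file records its UNCONDITIONAL content with explicit thresholds, as a
constraint every counterexample to the crux must satisfy:

* ★ `card_blockPatterns_le_of_rank_lt` — if a balanced cut `π` of the `2n` bit positions has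
  `rank M_π < W` and `(t + 1)(t + T) ≤ n`, then the Liouville sequence shows AT MOST
  `2^{(2^W + W) · 2^t}` distinct sign patterns on the aligned blocks `[4^t H + 1, 4^t (H + 1)]`,
  `H < 2^T` — i.e. at most `2^{O_W(√B)}` of the `2^B` conceivable patterns of length `B = 4^t`, at every
  scale `t ≲ √n`, with the blocks ranging over `[1, 4^t · 2^T]`.
  (A balanced `2t`-window with `T` free positions above it exists
  (`OneBlock.exists_balancedWindow_margin`); every aligned block `H < 2^T` embeds as a minor
  (`OneBlock.rank_inducedCut_shift_le`), so it has `< W` rank, `≤ 2^{W-1}` distinct rows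
  (`LiouvilleSarnakAligned.card_image_row_le_two_pow_rank`), and the counting lemma
  `BlockEntropy.card_le_of_card_image_rows_le` bounds the patterns.)
* `exists_repeated_blockPattern_of_rank_lt` — pigeonhole form: some aligned `4^t`-block pattern of `λ`
  then occurs at `≥ 2^T / 2^{(2^W + W) 2^t}` of the block positions `H < 2^T` (massive repetition of
  blocks of length `≍ (log X)²` below `X`, when `T ≫ 2^W 2^t`).

Honest framing: necessary conditions on counterexamples only; `LiouvilleCutRank`,
`DigitalBilinearLiouville`, `AlgebraicSarnak` stay OPEN; nothing here bears on VP versus VNP.  No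
definitions.
-/

-- the directory `ValiantsHypothesis/ValiantsHypothesis` repeats the summit name (tree layout)
set_option linter.dupNamespace false

namespace Summit.ValiantsHypothesis.ValiantsHypothesis.Theorems.LiouvilleSarnakLiouvilleCutRank.BlockEntropy

open Finset ArithmeticFunction

open Summit.ValiantsHypothesis.ValiantsHypothesis.Theorems.LiouvilleSarnakAligned
  (card_image_row_le_two_pow_rank)
open Summit.ValiantsHypothesis.ValiantsHypothesis.Theorems.LiouvilleSarnakLiouvilleCutRank.OneScale
  (exists_inducedCut)
open Summit.ValiantsHypothesis.ValiantsHypothesis.Theorems.LiouvilleSarnakLiouvilleCutRank.OneBlock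
  (exists_balancedWindow_margin rank_inducedCut_shift_le blockMatrix_entry_eq_or)

/-- ★ **Structure of a counterexample cut.**  If a balanced cut `π` of `2n` positions has cut-matrix
rank `< W` (over `ℂ`) and `(t + 1)(t + T) ≤ n`, then the aligned blocks `[4^t H + 1, 4^t (H + 1)]`,
`H < 2^T`, of the Liouville sequence carry at most `2^{(2^W + W) · 2^t}` distinct sign patterns.
[folklore] -/
theorem card_blockPatterns_le_of_rank_lt (W t T n : ℕ) (hn : (t + 1) * (t + T) ≤ n)
    (π : Fin n ⊕ Fin n ≃ Fin (2 * n))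
    (hrank : (Matrix.of fun r c : Fin n → Bool =>
      (((liouville (Nat.ofBits (fun j : Fin (2 * n) => Sum.elim r c (π.symm j)) + 1) : ℤ) :
        ℂ))).rank < W) :
    ((range (2 ^ T)).image fun H : ℕ => fun i : Fin (2 ^ (2 * t)) =>
        (liouville (2 ^ (2 * t) * H + i + 1) : ℤ)).card ≤ 2 ^ ((2 ^ W + W) * 2 ^ t) := by
  classical
  -- a balanced `2t`-window with `T` free positions above it, and its induced cut `π₁`
  let w : ℕ → Bool := fun k => if hk : k < 2 * n then (π.symm ⟨k, hk⟩).isLeft else false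
  have hw : ∀ j : Fin (2 * n), w j = (π.symm j).isLeft := fun j => by simp [w, j.isLt]
  obtain ⟨s, hs, hcount⟩ := exists_balancedWindow_margin t T n hn π w hw
  obtain ⟨π₁, hπ₁⟩ := exists_inducedCut t s w hcount
  -- every aligned block `H < 2^T`, read through `π₁`, is a minor of `M_π`: rank `< W`
  have hblock : ∀ H < 2 ^ T, (Matrix.of fun r c : Fin t → Bool =>
      (((liouville (Nat.ofBits (fun j : Fin (2 * t) => Sum.elim r c (π₁.symm j)) +
        2 ^ (2 * t) * H + 1) : ℤ) : ℂ))).rank < W := by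
    intro H hHT
    have hH : H < 2 ^ (2 * n - (s + 2 * t)) :=
      lt_of_lt_of_le hHT (Nat.pow_le_pow_right Nat.two_pos (by omega))
    exact lt_of_le_of_lt
      (rank_inducedCut_shift_le t n π w s (by omega) (fun j _ _ => hw j) π₁ hπ₁ H hH) hrank
  have hW : 1 ≤ W := by have := hblock 0 (Nat.two_pow_pos T); omega
  -- counting
  set S : Finset (Fin (2 ^ (2 * t)) → ℤ) := (range (2 ^ T)).image fun H : ℕ =>
      fun i : Fin (2 ^ (2 * t)) => (liouville (2 ^ (2 * t) * H + i + 1) : ℤ) with hS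
  let N : (Fin t → Bool) → (Fin t → Bool) → Fin (2 ^ (2 * t)) := fun r c =>
    ⟨Nat.ofBits (fun j : Fin (2 * t) => Sum.elim r c (π₁.symm j)), Nat.ofBits_lt_two_pow _⟩
  have hN : ∀ i, ∃ r c, N r c = i := exists_cutPair_eq t π₁
  have hpm : ∀ p ∈ S, ∀ i, p i = 1 ∨ p i = -1 := by
    intro p hp i
    obtain ⟨H, -, rfl⟩ := mem_image.mp hp
    exact liouville_succ_eq_or _
  have hrows : ∀ p ∈ S,
      (univ.image fun r : Fin t → Bool => fun c : Fin t → Bool => p (N r c)).card ≤ 2 ^ (W - 1) := by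
    intro p hp
    obtain ⟨H, hHm, rfl⟩ := mem_image.mp hp
    have hHT : H < 2 ^ T := mem_range.mp hHm
    have hle : (univ.image fun r : Fin t → Bool => fun c : Fin t → Bool =>
        (((liouville (Nat.ofBits (fun j : Fin (2 * t) => Sum.elim r c (π₁.symm j)) +
          2 ^ (2 * t) * H + 1) : ℤ) : ℂ))).card ≤ 2 ^ (Matrix.of fun r c : Fin t → Bool =>
        (((liouville (Nat.ofBits (fun j : Fin (2 * t) => Sum.elim r c (π₁.symm j)) +
          2 ^ (2 * t) * H + 1) : ℤ) : ℂ))).rank :=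
      card_image_row_le_two_pow_rank _ (blockMatrix_entry_eq_or t H π₁)
    rw [card_image_blockRows_eq] at hle
    have heq : (fun r : Fin t → Bool => fun c : Fin t → Bool =>
          (liouville (Nat.ofBits (fun j : Fin (2 * t) => Sum.elim r c (π₁.symm j)) +
            2 ^ (2 * t) * H + 1) : ℤ)) =
        (fun r : Fin t → Bool => fun c : Fin t → Bool =>
          (fun i : Fin (2 ^ (2 * t)) => (liouville (2 ^ (2 * t) * H + i + 1) : ℤ)) (N r c)) := by
      funext r c
      simp only [N, Nat.add_comm (Nat.ofBits _) (2 ^ (2 * t) * H)]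
    rw [heq] at hle
    refine hle.trans (Nat.pow_le_pow_right Nat.two_pos ?_)
    have := hblock H hHT
    omega
  have hcard := card_le_of_card_image_rows_le N hN (2 ^ (W - 1)) S hpm hrows
  rw [Fintype.card_fun, Fintype.card_fin, Fintype.card_bool] at hcard
  -- `(2^{W-1} + 1)^{2^t} · 2^{2^t (2^{W-1}+1)} ≤ (2^W)^{2^t} · 2^{2^t 2^W} = 2^{(2^W + W) 2^t}`
  have hE : 2 ^ (W - 1) + 1 ≤ 2 ^ W := by
    have h1 : 2 ^ W = 2 * 2 ^ (W - 1) := by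
      rw [← pow_succ']; congr 1; omega
    have h2 : 1 ≤ 2 ^ (W - 1) := Nat.one_le_two_pow
    omega
  calc S.card ≤ (2 ^ (W - 1) + 1) ^ 2 ^ t * 2 ^ (2 ^ t * (2 ^ (W - 1) + 1)) := hcard
    _ ≤ (2 ^ W) ^ 2 ^ t * 2 ^ (2 ^ t * 2 ^ W) :=
        Nat.mul_le_mul (Nat.pow_le_pow_left hE _)
          (Nat.pow_le_pow_right Nat.two_pos (Nat.mul_le_mul_left _ hE))
    _ = 2 ^ ((2 ^ W + W) * 2 ^ t) := by rw [← pow_mul, ← pow_add]; ring_nf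

/-- **Pigeonhole form: a counterexample forces a much-repeated block.**  Under the hypotheses of
`card_blockPatterns_le_of_rank_lt`, some sign pattern of length `4^t` occurs as the aligned block
`[4^t H + 1, 4^t (H + 1)]` of `λ` for at least `2^T / 2^{(2^W + W) 2^t}` values `H < 2^T`. [folklore] -/
theorem exists_repeated_blockPattern_of_rank_lt (W t T n : ℕ) (hn : (t + 1) * (t + T) ≤ n)
    (π : Fin n ⊕ Fin n ≃ Fin (2 * n))
    (hrank : (Matrix.of fun r c : Fin n → Bool =>
      (((liouville (Nat.ofBits (fun j : Fin (2 * n) => Sum.elim r c (π.symm j)) + 1) : ℤ) :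
        ℂ))).rank < W) :
    ∃ p : Fin (2 ^ (2 * t)) → ℤ,
      2 ^ T / 2 ^ ((2 ^ W + W) * 2 ^ t) ≤
        ((range (2 ^ T)).filter fun H : ℕ => (fun i : Fin (2 ^ (2 * t)) =>
          (liouville (2 ^ (2 * t) * H + i + 1) : ℤ)) = p).card := by
  classical
  set f : ℕ → (Fin (2 ^ (2 * t)) → ℤ) := fun H : ℕ => fun i : Fin (2 ^ (2 * t)) =>
      (liouville (2 ^ (2 * t) * H + i + 1) : ℤ) with hf
  have hcard := card_blockPatterns_le_of_rank_lt W t T n hn π hrank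
  have hSne : ((range (2 ^ T)).image f).Nonempty :=
    ⟨f 0, mem_image_of_mem f (mem_range.mpr (Nat.two_pow_pos T))⟩
  -- a fibre of at least average size
  obtain ⟨p, hp, hmax⟩ := exists_max_image ((range (2 ^ T)).image f)
    (fun p => ((range (2 ^ T)).filter fun H => f H = p).card) hSne
  refine ⟨p, ?_⟩
  have hsum : ∑ q ∈ (range (2 ^ T)).image f, ((range (2 ^ T)).filter fun H => f H = q).card =
      2 ^ T := by
    rw [← card_eq_sum_card_image f (range (2 ^ T)), card_range]
  have hle : 2 ^ T ≤ ((range (2 ^ T)).image f).card *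
      ((range (2 ^ T)).filter fun H => f H = p).card := by
    calc 2 ^ T = ∑ q ∈ (range (2 ^ T)).image f, ((range (2 ^ T)).filter fun H => f H = q).card :=
          hsum.symm
      _ ≤ ∑ q ∈ (range (2 ^ T)).image f, ((range (2 ^ T)).filter fun H => f H = p).card :=
          sum_le_sum fun q hq => hmax q hq
      _ = _ := by rw [sum_const, smul_eq_mul]
  have hpos : 0 < 2 ^ ((2 ^ W + W) * 2 ^ t) := Nat.two_pow_pos _
  calc 2 ^ T / 2 ^ ((2 ^ W + W) * 2 ^ t)
      ≤ (((range (2 ^ T)).image f).card * ((range (2 ^ T)).filter fun H => f H = p).card) /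
          2 ^ ((2 ^ W + W) * 2 ^ t) := Nat.div_le_div_right hle
    _ ≤ (2 ^ ((2 ^ W + W) * 2 ^ t) * ((range (2 ^ T)).filter fun H => f H = p).card) /
          2 ^ ((2 ^ W + W) * 2 ^ t) :=
        Nat.div_le_div_right (Nat.mul_le_mul_right _ hcard)
    _ = ((range (2 ^ T)).filter fun H => f H = p).card := by
        rw [Nat.mul_div_cancel_left _ hpos]

end Summit.ValiantsHypothesis.ValiantsHypothesis.Theorems.LiouvilleSarnakLiouvilleCutRank.BlockEntropy
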